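import Mathlib
import HarnessLib
import HarnessLib.Audit
import Summits.Parity.Statement
import Literature.NumberTheory.Sieve.LevelOfDistribution
import Literature.NumberTheory.Sieve.SingularSeries

/-!
Route: DenseShiftedProducts

CLOSED (retired) 2026-08-15T13:49:38Z by operator:999:1257524 — reason: not-a-thesis: assembly does not conclude the sub-problem Statement — note: D-0027 §2.1 audit (human 2026-08-15: routes that do not decide the summit are removed): the assembly concludes `ThresholdOneParity`, not the sub-problem statement; a NEW conforming route may be opened from the same idea (generated `closes : … → _root_.GeneralizedHardyLittlewood`).. The file is kept as the record of this route; refuted decls are indexed as negative knowledge (`ledger negatives`).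

# Route DenseShiftedProducts — st+2 prime on dense product sets once dens S + dens T > 1, by
HL-inverse doubly-stochastic transport at fixed-residue level ½; the threshold 1 is Liouville parity

THEOREM + BARRIER ROUTE (declared up front, like TargetGraphParity): X does NOT imply
Summit.Parity.GeneralizedHardyLittlewood and is
not claimed to; the Assembly concludes in the Target `ThresholdOneParity`, and the deliverables are
(i) a new unconditional theorem in the
twin-prime orbit for Summits/Parity/GeneralizedHardyLittlewood/Theorems and (ii) the exact location
of the parity wall for prime detection
on product sets by density. Realises card dense-shifted-products-konig (spine). Setting: N large,
O_N = odd n ≤ N (n = |O_N| ≈ N/2), the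
bipartite "shifted multiplication table" graph on O_N ⊔ O_N with an edge st ↔ st+2 prime. X = DSP ∧
SHARP ("it suffices to show"):
DSP (DenseShiftedPrimes, threshold ONE): for every ε > 0 there is c(ε) > 0 such that for N ≥ N₀(ε)
and all S, T ⊆ O_N with
|S| + |T| ≥ (1+ε)·n, #{(s,t) ∈ S×T : st+2 prime} ≥ c N²/log N. Mechanism: weight each edge by the
INVERSE of its Hardy–Littlewood
probability, ω(s,t) = 1_P(st+2)·log(st+2)/(C₂ N G(st)), G(m) = Π_{p|m, p>2}(p−1)/(p−2); then every
row/column sum has main term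
EXACTLY 1 (the Euler factors Π_{p|s} and Π_{p∤2s} recombine to C₂), the error being a finite
combination of θ(sN+2; sd, 2) − (sN+2)/φ(sd)
— fixed residue 2, moduli sd ≤ K·√(length): Type-I information at level exactly ½ with constants,
supplied in ℓ¹ over moduli by
Bombieri–Friedlander–Iwaniec II/III (crux FixedResidueSqrtLevel). Trimming the o(n) irregular lines,
plain inclusion–exclusion on an
almost doubly stochastic matrix gives X(S×T) ≥ |S| + |T| − n − O(η)n with NO sieve constant, and ω ≤
3 log N/(C₂N) turns mass into ≫ N²/log N
prime pairs (support TransportCount); König/defect Hall gives a prime transversal of the table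
(support PrimeTransversal).
SHARP (ParityTightness): any version of DSP with threshold c·n, c < 1, forces #{p ≤ x : λ(p−2) = +1}
≫ x/(log x)^A AND the same for −1
(Pintz-type sign problems for the fixed shift 2, open), because S = T = {λ = +1} resp. S = {λ=+1}, T
= {λ=−1} have |S|+|T| = n + o(n) and
st+2 = p forces λ(p−2) = λ(s)λ(t): the provable threshold sits exactly at the parity point 1,
congruence obstructions stop at 2/3
({1 mod 3}²), and the conjectural truth is DSP* (threshold 2/3 + ε, filed for refuters only in
words).
Lean: `(∀ ε : ℝ, 0 < ε → ∃ c : ℝ, 0 < c ∧ ∃ N₀ : ℕ, ∀ N : ℕ, N₀ ≤ N → ∀ S T : Finset ℕ, S ⊆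
(Finset.Icc 1 N).filter (fun n : ℕ => Odd n) → T ⊆ (Finset.Icc 1 N).filter (fun n : ℕ => Odd n) → (1
+ ε) * ((((Finset.Icc 1 N).filter (fun n : ℕ => Odd n)).card : ℕ) : ℝ) ≤ (S.card : ℝ) + (T.card : ℝ)
→ c * (N : ℝ) ^ 2 / Real.log (N : ℝ) ≤ ((((S ×ˢ T).filter (fun p : ℕ × ℕ => (p.1 * p.2 +
2).Prime)).card : ℕ) : ℝ)) ∧ ((∃ c : ℝ, c < 1 ∧ ∃ c₁ : ℝ, 0 < c₁ ∧ ∃ N₀ : ℕ, ∀ N : ℕ, N₀ ≤ N → ∀ S T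
: Finset ℕ, S ⊆ (Finset.Icc 1 N).filter (fun n : ℕ => Odd n) → T ⊆ (Finset.Icc 1 N).filter (fun n :
ℕ => Odd n) → c * ((((Finset.Icc 1 N).filter (fun n : ℕ => Odd n)).card : ℕ) : ℝ) ≤ (S.card : ℝ) +
(T.card : ℝ) → c₁ * (N : ℝ) ^ 2 / Real.log (N : ℝ) ≤ ((((S ×ˢ T).filter (fun p : ℕ × ℕ => (p.1 * p.2
+ 2).Prime)).card : ℕ) : ℝ)) → ∀ σ : ℤ, (σ = 1 ∨ σ = -1) → ∃ A c' : ℝ, 0 < c' ∧ ∃ x₀ : ℕ, ∀ x : ℕ,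
x₀ ≤ x → c' * (x : ℝ) / Real.log (x : ℝ) ^ A ≤ ((((Finset.range (x + 1)).filter (fun p : ℕ =>
p.Prime ∧ 3 ≤ p ∧ ArithmeticFunction.liouville (p - 2) = σ)).card : ℕ) : ℝ))`

## Assembly
Pure logic given the two glue statements (checked sorry-free as an `example` in the planner's
Sketch.lean): from h₂ : FixedResidueSqrtLevel
and h₃ : RowSumsNearOne (whose hypothesis is h₂ verbatim) get row regularity; TransportCount with
LineSumsBounded turns it into DSP
(conjunct 1); h₄ : ParityTightness is conjunct 2 verbatim. Nothing here implies
Summit.Parity.GeneralizedHardyLittlewood (declared: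
theorem + barrier route; the Target is the deliverable).

Rationale: WHY THIS LINE. It brings transport/matching duality (König–Egerváry, Hoffman's ratio bound: a graph
carrying a symmetric doubly stochastic matrix has
independence ratio ≤ ½) to bear on a prime-detection problem, and the point is quantitative:
normalising by the HL singular series instead
of a Brun–Titchmarsh majorant makes the pigeonhole LOSSLESS, so the threshold drops from 2 − 1/(2K)
(K = pair-sieve constant) to exactly 1,
where it meets a certified parity obstruction rather than a congruence. The only deep input is the
fixed-residue ℓ¹ mean-value theorem
just beyond √x (BombieriFriedlanderIwaniec1987 main theorem and BombieriFriedlanderIwaniec1989 Thm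
1, quoted verbatim in Fiorilli2012
Thms 1.1–1.2, arXiv:1108.0439 p. 2; context Maynard2025 = arXiv:2006.08250 §1), i.e. the dispersion
method — discrepancy of the table
(Type II for shifted primes, parity-complete: routes ShiftedMultiplicationTable,
MobiusShiftedPrimes) is NOT needed, only approximate
bi-regularity of line sums. In Polymath8b2014 §8 language, DSP is the positive-density, one-sided
regime of the bilinear shifted-prime sums
Σ_{s∈S}Σ_{t∈T} Λ(st+2) whose signed control "would soon lead to a proof of the twin prime
conjecture"; the route proves what density alone
gives (everything above 1) and proves that going below 1 is a λ-sign problem (ParityTightness) — the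
product-set sibling of
Literature.Barriers.Parity.CriticalDensityHalf, with the Liouville level set in the role of {0,1 mod
4}. No existing route or negative
(index empty) treats dense product sets; nearest literature is the Sárközy–Stewart circle on prime
FACTORS of ab+1 (GyorySarkozyStewart1996,
doi:10.5486/pmd.2000.2321) and density thresholds for ADDITIVE prime problems (Shao2014, 5/8).

RANKED CRUXES. #0 ThresholdOneParity (target) — X = DSP ∧ SHARP of § Thesis written out: (∀ε>0 ∃c>0
∃N₀ ∀N≥N₀ ∀S,T ⊆ O_N, (1+ε)|O_N| ≤ |S|+|T| → c N²/log N ≤ #{(s,t)∈S×T : st+2 prime}) ∧ ((∃c<1, DSP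
with threshold c·|O_N|) → for σ = ±1: #{p ≤ x prime, p ≥ 3, λ(p−2) = σ} ≥ c′x/(log x)^A for some A,
c′ > 0 and all large x). (why it might fail: Conjunct 1 inherits crux 2 (a printed theorem, hard to
formalise) and crux 3; conjunct 2 is provable now. DSP itself could only fail if the HL-inverse
weight were not asymptotically doubly stochastic — numerically it is (row sums 1 ± 0.03 at N = 10⁵,
1 ± 0.008 at N = 10⁶; folder kit/rowsums.py).) [BombieriFriedlanderIwaniec1987,
BombieriFriedlanderIwaniec1989, Fiorilli2012, Pintz2015, Lichtman2020, HardyLittlewood1923]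
#2 FixedResidueSqrtLevel (crux) — (card Crux 2, minimal form) Fixed-residue level of distribution
EXACTLY ½ with constants, in ℓ¹ over all moduli: for every integer a ≠ 0 and every K > 0, Σ_{q ≤
K√x, (q,a)=1} |ψ(x; q, a) − x/φ(q)| = o(x) as x → ∞ (ψ(x;q,a) = tree `chebyshevPsiMod`). In print:
BFI II main theorem (Fiorilli2012 Thm 1.1: Σ_{Q≤q<2Q,(q,a)=1}|ψ(x;q,a) − x/φ(q)| ≪_a x (log y/log
x)² (log log x)^B whenever Q² ≤ xy, y ≥ 3) summed over the O(log log x + log K) dyadic blocks above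
x^{1/2}(log x)^{−B′} with y = 4K² + 3, plus Bombieri–Vinogradov (tree theorem
bombieri_vinogradov_holds) or BFI II again below; a fortiori from BFI III Thm 1 (Fiorilli2012 Thm
1.2, arbitrary intervals of moduli, saving K(θ−½)²). Used only with a = 2 (and a = −2 for the st−2
variant). [difficulty: XL] (why it might fail: True in print (BFI II main thm = Fiorilli2012 Thm
1.1; BFI III Thm 1), so it fails only as a Lean target: the proofs run Linnik's dispersion method on
Deshouillers–Iwaniec bounds for sums of Kloosterman sums, absent from Mathlib and the tree (whose
BFI 1986 Thms 1, 2, 5 are still unproved leaves).) [BombieriFriedlanderIwaniec1987,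
BombieriFriedlanderIwaniec1989, Fiorilli2012, arXiv:1108.0439, BombieriFriedlanderIwaniecActa1986,
Maynard2025, arXiv:2006.08250, Literature.Barriers.Parity.LargeSieveLevelHalf]
#3 RowSumsNearOne (crux) — (card Crux 3(i)+(iii), the problem-specific heart) FixedResidueSqrtLevel
(inlined as hypothesis) implies: for every η > 0 and N ≥ N₀(η), all but at most ηN odd s ≤ N have
row sum R_N(s) = Σ_{t odd ≤ N} ω_N(s,t) ∈ [1−η, 1+η], where ω_N(s,t) = 1_P(st+2) log(st+2)/(C₂ N
G(st)), G(m) = Π_{p|m,p>2}(p−1)/(p−2), C₂ = tree twinPrimeConst. Proof plan: 1/G(st) = G(s)⁻¹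
Σ_{d|t,(d,2s)=1} μ(d)ν(d), ν(p) = 1/(p−1), so R_N(s) = (C₂NG(s))⁻¹ Σ_{(d,2s)=1} μ(d)ν(d)(θ(sN+2; sd,
2) − log 2) EXACTLY (t odd is automatic); inserting θ(y;q,2) = y/φ(q) + E the main term is
(s/(C₂G(s)φ(s)))·Π_{p∤2s}(1−1/(p−1)²) = 1 identically (s/(G(s)φ(s)) = Π_{p|s}(1−1/(p−1)²)); cut d at
D₀(η) (tail ≤ η/3 by Brun–Titchmarsh since Σ_{d>D₀}ν(d)/φ(d) → 0, trivial bound for sd >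
(sN)^{0.9}); for d ≤ D₀ group s into blocks (S,(1+δ)S], freeze the length at SN+2 (Brun–Titchmarsh
on the increments: total cost O(δN²)), and bound Σ_{s in block}|E(SN+2; sd, 2)| by the hypothesis at
x = SN+2, K = 2D₀ (moduli sd ≤ 2D₀√(SN)); summing the geometric blocks gives Σ_s Σ_{d≤D₀} ν(d)|E| =
o(N²)/δ + O(δN²) = o(N²) with δ = δ(N) → 0 slowly; Markov then bounds the exceptional rows. By
symmetry ω_N(s,t) = ω_N(t,s) the same holds for columns. [deps: FixedResidueSqrtLevel] [difficulty:
L] (why it might fail: The identity (main term ≡ 1) is exact and numerically confirmed (N = 10⁶: sd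
0.003); the risk is bookkeeping: the length sN+2 moves with the modulus sd, so the ℓ¹ input is
applied on (1+δ)-blocks of s with Brun–Titchmarsh interpolation, and the d-sum is cut at D₀(η)
BEFORE invoking level K√x.) [HardyLittlewood1923, Shiu1980, Fiorilli2012,
BombieriFriedlanderIwaniec1987, IwaniecKowalski2004,
Summits/Parity/GeneralizedHardyLittlewood/Ideas/dense-shifted-products-konig.md]
#4 ParityTightness (crux) — (card Crux 4, in the refuter-corrected form) If DSP held with some
threshold c < 1 (∃c<1 ∃c₁>0 ∃N₀ ∀N≥N₀ ∀S,T ⊆ O_N with c·|O_N| ≤ |S|+|T|: #{(s,t)∈S×T: st+2 prime} ≥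
c₁N²/log N), then for σ = +1 and for σ = −1 there are A, c′ > 0 with #{3 ≤ p ≤ x prime : λ(p−2) = σ}
≥ c′x/(log x)^A for all large x. Proof plan: σ = −1: S = {λ=+1}, T = {λ=−1} ∩ O_N (|S|+|T| = n); σ =
+1: S = T = {λ=+1} ∩ O_N (|S|+|T| = n + Σ_{n≤N odd}λ(n) = n + o(n), PNT-strength); st+2 = p ⟹ λ(p−2)
= λ(s)λ(t) = σ (complete multiplicativity); pairs → distinct primes by Cauchy–Schwarz against
Σ_{m≤N²}τ(m)² ≪ N²(log N)³ (elementary), giving ≫ N²/(log N)⁵ primes p ≤ N²+2, then interpolate x ↦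
N = ⌊√(x−2)⌋. This certifies that the threshold 1 of DSP is the parity point: c < 1 is at least a
quantitative Pintz sign problem for the fixed shift 2 (both signs), cf.
Literature.NumberTheory.Sieve.MoebiusShiftedPrimesConjecture (its o(π)-form) and Pintz2015 (sign of
λ(p+d) only for SOME |d| ≤ 16). [difficulty: M] (why it might fail: Sign −1 uses S={λ=1}, T={λ=−1}
(|S|+|T| = n, needs only c < 1); sign +1 uses S=T={λ=1} and Σ_{n≤N odd} λ(n) = o(N) (PNT-strength;
tree status to check); pairs→distinct primes loses (log N)⁴ via Στ(m)², so only the (log x)^{−A}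
form is claimed — the card's 'positive density' is NOT.) [Pintz2015, Lichtman2020, MurtyVatwani2017,
Literature.NumberTheory.Sieve.MoebiusShiftedPrimesConjecture,
Literature.Barriers.Parity.CriticalDensityHalf, Tao2012CircleMethodBlog]
#9 LineSumsBounded (support) — (card Crux 3(ii)) Uniform bound for every line: there are K and N₀
with R_N(s) ≤ K for all N ≥ N₀ and all odd s ≤ N. Proof plan: 1/G(st) ≤ 1/G(s), log(st+2) ≤ 3 log N,
and Brun–Titchmarsh π(sN+2; s, 2) ≤ C·sN/(φ(s) log N) (any constant C; modulus s ≤ √(sN); from the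
tree theorem Shiu1980BrunTitchmarsh_holds with f = indicator of N^{1/4}-rough numbers, or the tree's
upper-bound sieve) give R_N(s) ≤ 3C s/(C₂φ(s)G(s)) ≤ 3C/C₂ because s/(φ(s)G(s)) =
Π_{p|s}(1−1/(p−1)²) ≤ 1. K ≈ 6/C₂ with C = 2. [difficulty: provable-now] [Shiu1980,
MontgomeryVaughan2007, HardyLittlewood1923]
#9 TransportCount (support) — (card mechanism, the transport/inclusion–exclusion step; pure
combinatorics + bookkeeping) [conclusion of RowSumsNearOne: ∀η>0, eventually ≤ ηN rows with
|R_N(s)−1| > η] → [LineSumsBounded] → DSP. Proof plan: columns = rows by the symmetry ω_N(s,t) =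
ω_N(t,s); with B = exceptional lines (|B| ≤ 2·ηN... ≤ 4ηn), X(S×T) ≥ X(S×O_N) − X(O_N×Tᶜ) =
Σ_{s∈S}R(s) − Σ_{t∉T}C(t) ≥ (|S|−|B|)(1−η) − [(n−|T|)(1+η) + K|B|] ≥ |S|+|T|−n−(4+2K)·2ηn; with
|S|+|T| ≥ (1+ε)n and η = ε/(8(2+K)) this is ≥ εn/2 ≥ εN/5; every edge weight is ≤ log(N²+2)/(C₂N) (G
≥ 1, C₂ > 0 by tree twinPrimeConst_pos_holds), so #{(s,t)∈S×T: st+2 prime} ≥ (εN/5)·C₂N/(3 log N) =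
(εC₂/15)·N²/log N. [difficulty: provable-now] [HardyLittlewood1923,
Summits/Parity/GeneralizedHardyLittlewood/Ideas/dense-shifted-products-konig.md]
#9 PrimeTransversal (support) — (card support: the König / prime-transversal corollary) DSP → for
every ε > 0 and N ≥ N₀: there is S′ ⊆ O_N with |S′| ≥ (1−ε)|O_N| and an injection f : S′ → O_N with
s·f(s)+2 prime for all s ∈ S′ ("an almost-perfect prime matching of the shifted multiplication
table"). Proof plan: by DSP(ε) no S×T with |S|+|T| ≥ (1+ε)n is edge-free, so every S ⊆ O_N has
|N(S)| > |S| − εn (take T = O_N∖N(S)); the defect form of Hall's theorem (Mathlib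
`Finset.all_card_le_biUnion_card_iff_exists_injective` applied after adjoining ⌈εn⌉ dummy columns
joined to every row) yields a matching of size ≥ n − εn. [difficulty: provable-now]
[Mathlib.Combinatorics.Hall.Basic,
Summits/Parity/GeneralizedHardyLittlewood/Ideas/dense-shifted-products-konig.md]

TWO-LAYER PLAN. Foreseen glued splits, filed only when a crux closes or stalls (k ≤ 3, depth 1):
RowSumsNearOne ⇐ RowIdentity (the exact formula for
R_N(s) and main term ≡ 1) → TailAndBlocks (d > D₀ tail + (1+δ)-block interpolation by
Brun–Titchmarsh) → RowSumsNearOne;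
FixedResidueSqrtLevel ⇐ DyadicBFI2 (the printed dyadic bound, Q² ≤ xy) → BelowSqrt (BV range, tree
theorem) → FixedResidueSqrtLevel, and
below DyadicBFI2 the literature seats' own DAG (dispersion on the tree's BFI 1986 Lemmas 1–2 /
Deshouillers–Iwaniec leaves);
ParityTightness ⇐ LiouvilleOddMeanZero → PairsToPrimes (Cauchy–Schwarz vs Στ²) → ParityTightness.

KILL CRITERIA. Nothing here is conjectural except feasibility: FixedResidueSqrtLevel is a theorem in
print and cannot be refuted; if a grounder shows the
printed BFI II/III statements do NOT yield o(x) at Q = K√x in ℓ¹ with a fixed residue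
(misquotation), restate crux 2 to the printed
dyadic form (route edit --restate) — if no printed form gives level K√x for every K, DSP at
threshold 1 is OPEN as stated and the
route is closed `refuted:FixedResidueSqrtLevel`-style by census (the line degrades to the one-sided
pigeonhole threshold 2 − C₂/4·…, not
worth a route). A kit run showing row sums NOT concentrating at 1 would kill the weighting (done:
they do, see Cheapest falsifier). A
formal refutation of ParityTightness can only be a convention slip (λ(0), p = 2): restate. If
MoebiusShiftedPrimes / ShiftedMultiplicationTable
prove λ(p−2) equidistributed, ParityTightness loses interest but DSP and PrimeTransversal stand as
theorems.

NOT DECOMPOSED YET. The block/tail bookkeeping constants of RowSumsNearOne (D₀(η), δ(N)), the ψ↔θ↔π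
normalisation lemmas, the defect-Hall lemma, the
Στ(m)² ≪ y log³y bound and Σ_{n≤N odd}λ(n) = o(N) are layer-2 children or `--supports` lemmas, not
items. Deliberately NOT filed: DSP*
(threshold 2/3 + ε: conjecturally the truth, parity-complete, refuter material only), the
general-shift / both-parities version (2-adic
factor of G), the relative version inside rough numbers (card (c): touches the wall only through the
classical sieve constant 2), and
st+2 = q₁q₂ targets (same threshold, no λ-wall) — none is load-bearing for X.

CHEAPEST FALSIFIER. (a) DONE here (folder kit/rowsums.py, logs local_run*.log, pure arithmetic,
reproducible in seconds): the row sums R_N(s) of the explicit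
weight concentrate at 1 — N = 10⁴, all 5000 rows: mean 0.9992, sd 0.023, max |R−1| = 0.094; N = 10⁵,
510 sampled rows: mean 1.0003, sd
0.0089, max 0.029; N = 10⁶, 210 rows: mean 1.0002, sd 0.0030, max 0.0084 (deviations ≈ Poisson noise
1/√#primes-in-row; no bias, no bad
rows) — the doubly-stochastic normalisation is right. (b) The refuter's exact ILP (card audit):
symmetric independence number of the
table = best mod-3 class exactly for N ≤ 1001 — consistent with DSP* and with DSP. (c) Remaining
cheapest check = a page read of BFI II
(Math. Ann. 277, main theorem) / BFI III (JAMS 2, Thm 1; open access) against crux 2: fixed a, ALL q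
in a dyadic range, absolute values,
bound o(x)-quality at Q = K√x; Fiorilli2012 Thms 1.1–1.2 (held, arXiv:1108.0439 p. 2) already print
exactly this.

NUMBERS. C₂ = twinPrimeConst = 0.66016…; line-sum bound K ≤ 3C/C₂ with Brun–Titchmarsh constant C (=
2: K ≈ 9.1; empirically max R ≤ 1.13 at
N = 3000 and ≤ 1.03 at N = 10⁵). Thresholds for |S|+|T| in units of n = |O_N|: congruence
obstructions 2/3 ({1 mod 3}², exact for N ≤ 1001
by the audit's ILP); Liouville obstruction 1 (under either sign hypothesis for λ(p−2)); this route's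
theorem 1 + ε; naive pigeonhole with a
Brun–Titchmarsh normaliser 2 − 1/(2K_sieve) (7/8·2 at level ½, 3/4·2 under EH). Fixed-residue levels
in print: ℓ¹ with absolute values
x^{1/2+o(1)} (BFI II: Q = x^{1/2}exp(log x/(log log x)^B); BFI III: any x^{1/2+o(1)}, saving
K(θ−½)²); well-factorable 4/7 (BFI 1986 Thm 10),
3/5 triply-well-factorable (Maynard II); uniform residues need a divisor of size ≈ x^{1/10}
(Maynard2025 Thm 1.1). Items at open: 8.

DEFINITION REQUESTS. None. Everything is inlined over Mathlib + tree declarations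
(Literature.NumberTheory.Sieve.LevelOfDistribution.chebyshevPsiMod,
Literature.NumberTheory.Sieve.twinPrimeConst, ArithmeticFunction.liouville, Nat.primeFactors); the
weight G and ω are bound by
`∀ G, (∀ m, G m = …) →` inside each statement so no new definition is needed. Facts wanted as
theorems (not hypotheses): none beyond crux 2.

Novelty: Searches (2026-08-15, this seat; searchd/zbMATH/OpenAlex/arXiv APIs were down or rate-limited,
recorded in NOTES): `lit frontier Parity
--since 2020` (30 rows; nearest arXiv:2605.01155 random Bateman–Horn sets, arXiv:2402.11884 large
prime factors — neither on dense product
sets); `lit bridges Parity --cross any` (generic textbooks); `lit galaxy search "ab+1 is a prime"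
--star all` (0), `"primes in product sets"
--star all` (0), `--star pdf "doubly stochastic" title:primes` (0 relevant); `lit search --source
crossref "prime factors of integers of the
form ab+1"` (12: Sárközy–Stewart 2000 doi:10.5486/pmd.2000.2321, GyorySarkozyStewart1996, Stewart
2002 doi:10.1023/a:1015281515087, Stewart
2008 CRM survey doi:10.1090/crmp/046/21 — all on prime FACTORS ω(ab+1), P(ab+1), never primality);
`--source crossref "shifted product sets
primes density"` (12, none relevant); local `lit search` BFI large moduli (15 held: Fiorilli2012 =
arXiv:1108.0439 and Maynard2025 =
arXiv:2006.08250 read, pp. 1–6, for the exact BFI II/III statements). Plus the card author's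
galaxy/intelligent sweep and the refuter audit's
zbMATH×6 / crossref×2 / S2 / galaxy×5 (card front-matter: nothing states DSP, its threshold, or the
HL-inverse weighting; 3 paywalled
Sárközy problem lists pending acq-01994/01998/02001).
Nearest prior art found: GyorySarkozyStewart1996 and Sárközy–Stewart 2000
(doi:10.5486/pmd.2000.2321): dense A, B ⊆ [1,N] ⟹ ab+1 has
many / large prime factors (P(ab+1) results), primality never reach  [refs: 10.5486/pmd.2000.2321, 10.1023/a:1015281515087, 10.1090/crmp/046/21, 2605.01155, 2402.11884, 1108.0439, 2006.08250, 1206.6139, doi:10.5486/pmd.2000.2321, doi:10.1023/a, doi:10.1090/crmp/046/21, GyorySarkozyStewart1996, Fiorilli2012, Maynard2025, Shao2014, BombieriFriedlanderIwaniec1987]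

Barriers (technique_class: transport-duality, bipartite-matching, dispersion-level-half): - technique_class: transport-duality, bipartite-matching, dispersion-level-half
- Literature.Barriers.Parity.CriticalDensityHalf: met head-on and LOCATED rather than evaded: the
barrier's dense-model statement (density ≤ ½ models can be twin-free, {0,1 mod 4}) has here its
product-set sibling — each factor set of density ≤ ½ can be shifted-prime-free for a λ-reason — and
the route proves the positive statement for density-sum > 1 plus the theorem (ParityTightness) that
< 1 is a λ-sign problem; no Gowers-uniformity/transference is used, so the finite-complexity scope
clause does not apply.
- Literature.Barriers.Parity.LargeSieveLevelHalf: applies squarely to crux 2 (moduli K√x > √x/(log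
x)^B are beyond every large-sieve proof) and is evaded exactly as the catalogue's evasions_known
line says: fixed residue a = 2, dispersion + Kloosterman (BFI II/III), ℓ¹ without max over residues
— which is all the row sums need.
- Literature.Barriers.Parity.SelbergParityBarrier: not met: no lower-bound sieve is run and no
Type-I-only deduction of a prime count is made; the prime count in S×T comes from first moments of
PRIMES in progressions (θ(y; q, 2) asymptotics), i.e. the primes are an input, not sifted out; the
barrier reappears only as the content of ParityTightness (threshold < 1 ⟹ parity-breaking
information).
- Literature.Barriers.Parity.PrimePairParity: consistent: DSP is a one-sided positive-density
statement about Σ_{s∈S,t∈T}Λ(st+2), not the signed bilinear control Polymath name a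

History (route lifecycle, newest last):
- 2026-08-15T13:49:38Z · CLOSED retired — not-a-thesis: assembly does not conclude the sub-problem Statement (operator:999:1257524)

sub-problem: GeneralizedHardyLittlewood · status: closed(retired) · opened planner-plancard-Parity-GeneralizedHardyLittl-d89ea0b1-0 2026-08-15T12:19:55Z · rev 0 · ledger route-Parity-DenseShiftedProducts
GENERATED by the gate from the ledger (D-0016/17). Provers cite these decls: `theorem foo : Summit.Parity.GeneralizedHardyLittlewood.Theses.DenseShiftedProducts.<Decl> := …` in Summits/Parity/GeneralizedHardyLittlewood/Theorems/<Name>.lean.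
-/

namespace Summit.Parity.GeneralizedHardyLittlewood.Theses.DenseShiftedProducts

open scoped BigOperators Topology Manifold Classical MeasureTheory ProbabilityTheory Matrix InnerProductSpace ComplexConjugate ContinuousMap
open Filter Set Function TopologicalSpace MeasureTheory

attribute [summit_statement] _root_.GeneralizedHardyLittlewood

/-- item stmt-Parity-7921 · target · rank 0 · closed · moot by None · by planner
why it might fail: Conjunct 1 inherits crux 2 (a printed theorem, hard to formalise) and crux 3; conjunct 2 is provable now. DSP itself could only fail if the HL-inverse weight were not asymptotically doubly stochastic — numerically it is (row sums 1 ± 0.03 at N = 10⁵, 1 ± 0.008 at N = 10⁶; folder kit/rowsums.py).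
sources: BombieriFriedlanderIwaniec1987, BombieriFriedlanderIwaniec1989, Fiorilli2012, Pintz2015, Lichtman2020, HardyLittlewood1923
[target] X = DSP ∧ SHARP of § Thesis written out: (∀ε>0 ∃c>0 ∃N₀ ∀N≥N₀ ∀S,T ⊆ O_N, (1+ε)|O_N| ≤
|S|+|T| → c N²/log N ≤ #{(s,t)∈S×T : st+2 prime}) ∧ ((∃c<1, DSP with threshold c·|O_N|) → for σ =
±1: #{p ≤ x prime, p ≥ 3, λ(p−2) = σ} ≥ c′x/(log x)^A for some A, c′ > 0 and all large x). -/
@[route_item "route-Parity-DenseShiftedProducts"]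
def ThresholdOneParity : Prop :=
  (∀ ε : ℝ, 0 < ε → ∃ c : ℝ, 0 < c ∧ ∃ N₀ : ℕ, ∀ N : ℕ, N₀ ≤ N → ∀ S T : Finset ℕ, S ⊆ (Finset.Icc 1 N).filter (fun n : ℕ => Odd n) → T ⊆ (Finset.Icc 1 N).filter (fun n : ℕ => Odd n) → (1 + ε) * ((((Finset.Icc 1 N).filter (fun n : ℕ => Odd n)).card : ℕ) : ℝ) ≤ (S.card : ℝ) + (T.card : ℝ) → c * (N : ℝ) ^ 2 / Real.log (N : ℝ) ≤ ((((S ×ˢ T).filter (fun p : ℕ × ℕ => (p.1 * p.2 + 2).Prime)).card : ℕ) : ℝ)) ∧ ((∃ c : ℝ, c < 1 ∧ ∃ c₁ : ℝ, 0 < c₁ ∧ ∃ N₀ : ℕ, ∀ N : ℕ, N₀ ≤ N → ∀ S T : Finset ℕ, S ⊆ (Finset.Icc 1 N).filter (fun n : ℕ => Odd n) → T ⊆ (Finset.Icc 1 N).filter (fun n : ℕ => Odd n) → c * ((((Finset.Icc 1 N).filter (fun n : ℕ => Odd n)).card : ℕ) : ℝ) ≤ (S.card : ℝ) + (T.card :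 ℝ) → c₁ * (N : ℝ) ^ 2 / Real.log (N : ℝ) ≤ ((((S ×ˢ T).filter (fun p : ℕ × ℕ => (p.1 * p.2 + 2).Prime)).card : ℕ) : ℝ)) → ∀ σ : ℤ, (σ = 1 ∨ σ = -1) → ∃ A c' : ℝ, 0 < c' ∧ ∃ x₀ : ℕ, ∀ x : ℕ, x₀ ≤ x → c' * (x : ℝ) / Real.log (x : ℝ) ^ A ≤ ((((Finset.range (x + 1)).filter (fun p : ℕ => p.Prime ∧ 3 ≤ p ∧ ArithmeticFunction.liouville (p - 2) = σ)).card : ℕ) : ℝ))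

/-- item stmt-Parity-7922 · crux · rank 2 · closed · moot by None · by planner
why it might fail: True in print (BFI II main thm = Fiorilli2012 Thm 1.1; BFI III Thm 1), so it fails only as a Lean target: the proofs run Linnik's dispersion method on Deshouillers–Iwaniec bounds for sums of Kloosterman sums, absent from Mathlib and the tree (whose BFI 1986 Thms 1, 2, 5 are still unproved leaves).
sources: BombieriFriedlanderIwaniec1987, BombieriFriedlanderIwaniec1989, Fiorilli2012, arXiv:1108.0439, BombieriFriedlanderIwaniecActa1986, Maynard2025
[crux] (card Crux 2, minimal form) Fixed-residue level of distribution EXACTLY ½ with constants, in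
ℓ¹ over all moduli: for every integer a ≠ 0 and every K > 0, Σ_{q ≤ K√x, (q,a)=1} |ψ(x; q, a) −
x/φ(q)| = o(x) as x → ∞ (ψ(x;q,a) = tree `chebyshevPsiMod`). In print: BFI II main theorem
(Fiorilli2012 Thm 1.1: Σ_{Q≤q<2Q,(q,a)=1}|ψ(x;q,a) − x/φ(q)| ≪_a x (log y/log x)² (log log x)^B
whenever Q² ≤ xy, y ≥ 3) summed over the O(log log x + log K) dyadic blocks above x^{1/2}(log
x)^{−B′} with y = 4K² + 3, plus Bombieri–Vinogradov (tree theorem bombieri_vinogradov_holds) or BFI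
II again below; a fortiori from BFI III Thm 1 (Fiorilli2012 Thm 1.2, arbitrary intervals of moduli,
saving K(θ−½)²). Used only with a = 2 (and a = −2 for the st−2 variant). [difficulty: XL] -/
@[route_item "route-Parity-DenseShiftedProducts"]
def FixedResidueSqrtLevel : Prop :=
  ∀ a : ℤ, a ≠ 0 → ∀ K : ℝ, 0 < K → (fun x : ℝ => ∑ q ∈ (Finset.Icc 1 ⌊K * x ^ (1 / 2 : ℝ)⌋₊).filter (fun q : ℕ => IsCoprime (q : ℤ) a), |Literature.NumberTheory.Sieve.LevelOfDistribution.chebyshevPsiMod q (a : ZMod q) x - x / (Nat.totient q : ℝ)|) =o[Filter.atTop] (fun x : ℝ => x)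

/-- item stmt-Parity-7923 · crux · rank 3 · closed · moot by None · by planner
why it might fail: The identity (main term ≡ 1) is exact and numerically confirmed (N = 10⁶: sd 0.003); the risk is bookkeeping: the length sN+2 moves with the modulus sd, so the ℓ¹ input is applied on (1+δ)-blocks of s with Brun–Titchmarsh interpolation, and the d-sum is cut at D₀(η) BEFORE invoking level K√x.
sources: HardyLittlewood1923, Shiu1980, Fiorilli2012, BombieriFriedlanderIwaniec1987, IwaniecKowalski2004, Summits/Parity/GeneralizedHardyLittlewood/Ideas/dense-shifted-products-konig.md
[crux] (card Crux 3(i)+(iii), the problem-specific heart) FixedResidueSqrtLevel (inlined as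
hypothesis) implies: for every η > 0 and N ≥ N₀(η), all but at most ηN odd s ≤ N have row sum R_N(s)
= Σ_{t odd ≤ N} ω_N(s,t) ∈ [1−η, 1+η], where ω_N(s,t) = 1_P(st+2) log(st+2)/(C₂ N G(st)), G(m) =
Π_{p|m,p>2}(p−1)/(p−2), C₂ = tree twinPrimeConst. Proof plan: 1/G(st) = G(s)⁻¹ Σ_{d|t,(d,2s)=1}
μ(d)ν(d), ν(p) = 1/(p−1), so R_N(s) = (C₂NG(s))⁻¹ Σ_{(d,2s)=1} μ(d)ν(d)(θ(sN+2; sd, 2) − log 2)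
EXACTLY (t odd is automatic); inserting θ(y;q,2) = y/φ(q) + E the main term is
(s/(C₂G(s)φ(s)))·Π_{p∤2s}(1−1/(p−1)²) = 1 identically (s/(G(s)φ(s)) = Π_{p|s}(1−1/(p−1)²)); cut d at
D₀(η) (tail ≤ η/3 by Brun–Titchmarsh since Σ_{d>D₀}ν(d)/φ(d) → 0, trivial bound for sd >
(sN)^{0.9}); for d ≤ D₀ group s into blocks (S,(1+δ)S], freeze the length at SN+2 (Brun–Titchmarsh
on the increments: total cost O(δN²)), and bound Σ_{s in block}|E(SN+2; sd, 2)| by the hypothesis at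
x = SN+2, K = 2D₀ (moduli sd ≤ 2D₀√(SN)); summing the geometric blocks gives Σ_s Σ_{d≤D₀} ν(d)|E| =
o(N²)/δ + O(δN²) = o(N²) with δ = δ(N) → 0 slowly; Markov then bounds the exceptional rows. By
symmetry ω_N(s,t) = ω_N(t,s) the same holds for column -/
@[route_item "route-Parity-DenseShiftedProducts"]
def RowSumsNearOne : Prop :=
  (∀ a : ℤ, a ≠ 0 → ∀ K : ℝ, 0 < K → (fun x : ℝ => ∑ q ∈ (Finset.Icc 1 ⌊K * x ^ (1 / 2 : ℝ)⌋₊).filter (fun q : ℕ => IsCoprime (q : ℤ) a), |Literature.NumberTheory.Sieve.LevelOfDistribution.chebyshevPsiMod q (a : ZMod q) x - x / (Nat.totient q : ℝ)|) =o[Filter.atTop] (fun x : ℝ => x)) → ∀ η : ℝ, 0 < η → ∃ N₀ : ℕ, ∀ N : ℕ, N₀ ≤ N → ∀ G : ℕ → ℝ, (∀ m : ℕ, G m = ∏ p ∈ m.primeFactors.filter (fun p : ℕ => 2 < p), (((p : ℝ) - 1) / ((p : ℝ) - 2))) → (((((Finset.Icc 1 N).filter (fun n : ℕ => Odd n)).filter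 (fun s : ℕ => η < |(∑ t ∈ (Finset.Icc 1 N).filter (fun n : ℕ => Odd n), (if (s * t + 2).Prime then Real.log ((s * t + 2 : ℕ) : ℝ) / (Literature.NumberTheory.Sieve.twinPrimeConst * (N : ℝ) * G (s * t)) else (0 : ℝ))) - 1|)).card : ℕ) : ℝ) ≤ η * (N : ℝ)

/-- item stmt-Parity-7924 · crux · rank 4 · closed · moot by None · by planner
why it might fail: Sign −1 uses S={λ=1}, T={λ=−1} (|S|+|T| = n, needs only c < 1); sign +1 uses S=T={λ=1} and Σ_{n≤N odd} λ(n) = o(N) (PNT-strength; tree status to check); pairs→distinct primes loses (log N)⁴ via Στ(m)², so only the (log x)^{−A} form is claimed — the card's 'positive density' is NOT.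
sources: Pintz2015, Lichtman2020, MurtyVatwani2017, Literature.NumberTheory.Sieve.MoebiusShiftedPrimesConjecture, Literature.Barriers.Parity.CriticalDensityHalf, Tao2012CircleMethodBlog
[crux] (card Crux 4, in the refuter-corrected form) If DSP held with some threshold c < 1 (∃c<1
∃c₁>0 ∃N₀ ∀N≥N₀ ∀S,T ⊆ O_N with c·|O_N| ≤ |S|+|T|: #{(s,t)∈S×T: st+2 prime} ≥ c₁N²/log N), then for
σ = +1 and for σ = −1 there are A, c′ > 0 with #{3 ≤ p ≤ x prime : λ(p−2) = σ} ≥ c′x/(log x)^A for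
all large x. Proof plan: σ = −1: S = {λ=+1}, T = {λ=−1} ∩ O_N (|S|+|T| = n); σ = +1: S = T = {λ=+1}
∩ O_N (|S|+|T| = n + Σ_{n≤N odd}λ(n) = n + o(n), PNT-strength); st+2 = p ⟹ λ(p−2) = λ(s)λ(t) = σ
(complete multiplicativity); pairs → distinct primes by Cauchy–Schwarz against Σ_{m≤N²}τ(m)² ≪
N²(log N)³ (elementary), giving ≫ N²/(log N)⁵ primes p ≤ N²+2, then interpolate x ↦ N = ⌊√(x−2)⌋.
This certifies that the threshold 1 of DSP is the parity point: c < 1 is at least a quantitative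
Pintz sign problem for the fixed shift 2 (both signs), cf.
Literature.NumberTheory.Sieve.MoebiusShiftedPrimesConjecture (its o(π)-form) and Pintz2015 (sign of
λ(p+d) only for SOME |d| ≤ 16). [difficulty: M] -/
@[route_item "route-Parity-DenseShiftedProducts"]
def ParityTightness : Prop :=
  (∃ c : ℝ, c < 1 ∧ ∃ c₁ : ℝ, 0 < c₁ ∧ ∃ N₀ : ℕ, ∀ N : ℕ, N₀ ≤ N → ∀ S T : Finset ℕ, S ⊆ (Finset.Icc 1 N).filter (fun n : ℕ => Odd n) → T ⊆ (Finset.Icc 1 N).filter (fun n : ℕ => Odd n) → c * ((((Finset.Icc 1 N).filter (fun n : ℕ => Odd n)).card : ℕ) : ℝ) ≤ (S.card : ℝ) + (T.card : ℝ) → c₁ * (N : ℝ) ^ 2 / Real.log (N : ℝ) ≤ ((((S ×ˢ T).filter (fun p : ℕ × ℕ => (p.1 * p.2 + 2).Prime)).card : ℕ) : ℝ)) → ∀ σ : ℤ, (σ = 1 ∨ σ = -1) → ∃ A c' : ℝ, 0 < c' ∧ ∃ x₀ : ℕ, ∀ x : ℕ, x₀ ≤ x → c' * (x : ℝ) / Real.log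 (x : ℝ) ^ A ≤ ((((Finset.range (x + 1)).filter (fun p : ℕ => p.Prime ∧ 3 ≤ p ∧ ArithmeticFunction.liouville (p - 2) = σ)).card : ℕ) : ℝ)

/-- item stmt-Parity-7925 · support · rank 9 · closed · moot by None · by planner
sources: Shiu1980, MontgomeryVaughan2007, HardyLittlewood1923
[support] (card Crux 3(ii)) Uniform bound for every line: there are K and N₀ with R_N(s) ≤ K for all
N ≥ N₀ and all odd s ≤ N. Proof plan: 1/G(st) ≤ 1/G(s), log(st+2) ≤ 3 log N, and Brun–Titchmarsh
π(sN+2; s, 2) ≤ C·sN/(φ(s) log N) (any constant C; modulus s ≤ √(sN); from the tree theorem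
Shiu1980BrunTitchmarsh_holds with f = indicator of N^{1/4}-rough numbers, or the tree's upper-bound
sieve) give R_N(s) ≤ 3C s/(C₂φ(s)G(s)) ≤ 3C/C₂ because s/(φ(s)G(s)) = Π_{p|s}(1−1/(p−1)²) ≤ 1. K ≈
6/C₂ with C = 2. [difficulty: provable-now] -/
@[route_item "route-Parity-DenseShiftedProducts"]
def LineSumsBounded : Prop :=
  ∃ K : ℝ, ∃ N₀ : ℕ, ∀ N : ℕ, N₀ ≤ N → ∀ G : ℕ → ℝ, (∀ m : ℕ, G m = ∏ p ∈ m.primeFactors.filter (fun p : ℕ => 2 < p), (((p : ℝ) - 1) / ((p : ℝ) - 2))) → ∀ s ∈ (Finset.Icc 1 N).filter (fun n : ℕ => Odd n), (∑ t ∈ (Finset.Icc 1 N).filter (fun n : ℕ => Odd n), (if (s * t + 2).Prime then Real.log ((s * t + 2 : ℕ) : ℝ) / (Literature.NumberTheory.Sieve.twinPrimeConst * (N : ℝ) * G (s * t)) else (0 : ℝ))) ≤ K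

/-- item stmt-Parity-7926 · support · rank 9 · closed · moot by None · by planner
sources: HardyLittlewood1923, Summits/Parity/GeneralizedHardyLittlewood/Ideas/dense-shifted-products-konig.md
[support] (card mechanism, the transport/inclusion–exclusion step; pure combinatorics + bookkeeping)
[conclusion of RowSumsNearOne: ∀η>0, eventually ≤ ηN rows with |R_N(s)−1| > η] → [LineSumsBounded] →
DSP. Proof plan: columns = rows by the symmetry ω_N(s,t) = ω_N(t,s); with B = exceptional lines (|B|
≤ 2·ηN... ≤ 4ηn), X(S×T) ≥ X(S×O_N) − X(O_N×Tᶜ) = Σ_{s∈S}R(s) − Σ_{t∉T}C(t) ≥ (|S|−|B|)(1−η) −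
[(n−|T|)(1+η) + K|B|] ≥ |S|+|T|−n−(4+2K)·2ηn; with |S|+|T| ≥ (1+ε)n and η = ε/(8(2+K)) this is ≥
εn/2 ≥ εN/5; every edge weight is ≤ log(N²+2)/(C₂N) (G ≥ 1, C₂ > 0 by tree
twinPrimeConst_pos_holds), so #{(s,t)∈S×T: st+2 prime} ≥ (εN/5)·C₂N/(3 log N) = (εC₂/15)·N²/log N.
[difficulty: provable-now] -/
@[route_item "route-Parity-DenseShiftedProducts"]
def TransportCount : Prop :=
  (∀ η : ℝ, 0 < η → ∃ N₀ : ℕ, ∀ N : ℕ, N₀ ≤ N → ∀ G : ℕ → ℝ, (∀ m : ℕ, G m = ∏ p ∈ m.primeFactors.filter (fun p : ℕ => 2 < p), (((p : ℝ) - 1) / ((p : ℝ) - 2))) → (((((Finset.Icc 1 N).filter (fun n : ℕ => Odd n)).filter (fun s : ℕ => η < |(∑ t ∈ (Finset.Icc 1 N).filter (fun n : ℕ => Odd n), (if (s * t + 2).Prime then Real.log ((s * t + 2 : ℕ) : ℝ) / (Literature.NumberTheory.Sieve.twinPrimeConst * (N : ℝ) * G (s * t)) else (0 : ℝ))) - 1|)).card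 : ℕ) : ℝ) ≤ η * (N : ℝ)) → (∃ K : ℝ, ∃ N₀ : ℕ, ∀ N : ℕ, N₀ ≤ N → ∀ G : ℕ → ℝ, (∀ m : ℕ, G m = ∏ p ∈ m.primeFactors.filter (fun p : ℕ => 2 < p), (((p : ℝ) - 1) / ((p : ℝ) - 2))) → ∀ s ∈ (Finset.Icc 1 N).filter (fun n : ℕ => Odd n), (∑ t ∈ (Finset.Icc 1 N).filter (fun n : ℕ => Odd n), (if (s * t + 2).Prime then Real.log ((s * t + 2 : ℕ) : ℝ) / (Literature.NumberTheory.Sieve.twinPrimeConst * (N : ℝ) * G (s * t)) else (0 : ℝ))) ≤ K) → ∀ ε : ℝ, 0 < ε → ∃ c : ℝ, 0 < c ∧ ∃ N₀ : ℕ, ∀ N : ℕ, N₀ ≤ N → ∀ S T : Finset ℕ, S ⊆ (Finset.Icc 1 N).filter (fun n : ℕ => Odd n) → T ⊆ (Finset.Icc 1 N).filter (fun n : ℕ => Odd n) → (1 + ε) * ((((Finset.Icc 1 N).filter (fun n : ℕ => Odd n)).card : ℕ) : ℝ) ≤ (S.card : ℝ) + (T.card : ℝ) → c * (N : ℝ)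 ^ 2 / Real.log (N : ℝ) ≤ ((((S ×ˢ T).filter (fun p : ℕ × ℕ => (p.1 * p.2 + 2).Prime)).card : ℕ) : ℝ)

/-- item stmt-Parity-7927 · support · rank 9 · closed · moot by None · by planner
sources: Mathlib.Combinatorics.Hall.Basic, Summits/Parity/GeneralizedHardyLittlewood/Ideas/dense-shifted-products-konig.md
[support] (card support: the König / prime-transversal corollary) DSP → for every ε > 0 and N ≥ N₀:
there is S′ ⊆ O_N with |S′| ≥ (1−ε)|O_N| and an injection f : S′ → O_N with s·f(s)+2 prime for all s
∈ S′ ("an almost-perfect prime matching of the shifted multiplication table"). Proof plan: by DSP(ε)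
no S×T with |S|+|T| ≥ (1+ε)n is edge-free, so every S ⊆ O_N has |N(S)| > |S| − εn (take T =
O_N∖N(S)); the defect form of Hall's theorem (Mathlib
`Finset.all_card_le_biUnion_card_iff_exists_injective` applied after adjoining ⌈εn⌉ dummy columns
joined to every row) yields a matching of size ≥ n − εn. [difficulty: provable-now] -/
@[route_item "route-Parity-DenseShiftedProducts"]
def PrimeTransversal : Prop :=
  (∀ ε : ℝ, 0 < ε → ∃ c : ℝ, 0 < c ∧ ∃ N₀ : ℕ, ∀ N : ℕ, N₀ ≤ N → ∀ S T : Finset ℕ, S ⊆ (Finset.Icc 1 N).filter (fun n : ℕ => Odd n) → T ⊆ (Finset.Icc 1 N).filter (fun n : ℕ => Odd n) → (1 + ε) * ((((Finset.Icc 1 N).filter (fun n : ℕ => Odd n)).card : ℕ) : ℝ) ≤ (S.card : ℝ) + (T.card : ℝ) → c * (N : ℝ) ^ 2 / Real.log (N : ℝ) ≤ ((((S ×ˢ T).filter (fun p : ℕ × ℕ => (p.1 * p.2 + 2).Prime)).card : ℕ) : ℝ)) → ∀ ε : ℝ, 0 < ε → ∃ N₀ : ℕ, ∀ N : ℕ,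 N₀ ≤ N → ∃ S' : Finset ℕ, ∃ f : ℕ → ℕ, S' ⊆ (Finset.Icc 1 N).filter (fun n : ℕ => Odd n) ∧ (1 - ε) * ((((Finset.Icc 1 N).filter (fun n : ℕ => Odd n)).card : ℕ) : ℝ) ≤ (S'.card : ℝ) ∧ Set.InjOn f (↑S' : Set ℕ) ∧ ∀ s ∈ S', f s ∈ (Finset.Icc 1 N).filter (fun n : ℕ => Odd n) ∧ (s * f s + 2).Prime

/-- item stmt-Parity-7928 · assembly · rank 1 · closed · moot by None · by planner
sources: BombieriFriedlanderIwaniec1987, Fiorilli2012, HardyLittlewood1923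
[assembly] FixedResidueSqrtLevel → RowSumsNearOne → ParityTightness → ThresholdOneParity
(composition through the supports TransportCount and LineSumsBounded). -/
@[route_item "route-Parity-DenseShiftedProducts"]
def Assembly : Prop :=
  FixedResidueSqrtLevel → RowSumsNearOne → ParityTightness → ThresholdOneParity

end Summit.Parity.GeneralizedHardyLittlewood.Theses.DenseShiftedProducts
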